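import Mathlib
import Summits.MatrixMultiplication.Statement
import Summits.MatrixMultiplication.MatrixMultiplication.Theorems.GraphEquationsServeEngine
import Literature.Computability.AlgebraicComplexity.NonscalarBorderRank
import Literature.Computability.AlgebraicComplexity.SchoenhageTauBini
import Literature.Computability.AlgebraicComplexity.PartialMatrixMultiplicationProofs

/-!
# Graph equations — DEGENERATE READ-OUT: powers are free in border rank (M26, decomp-mm-lens-5 g36)

(supports `MultiplicityReduction`, stmt-MatrixMultiplication-27806.)  A family testing the pure
powers `f_q^k` (cost `N`) is read by the derivative tower at rank `≤ 2·3^{k-1}·N`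
(`GraphEquationsTowerSupply`), by the initial-form engine M8 (`tensorRank_le_of_initialForms`,
weighted truncation to order `K = 2k`) at `≤ 8k²·N`, and — being PURE — exactly at `2N` off the
graph (`GraphEquationsPureReadOut`, M27).  This file is the BORDER
form of the read-out, where the weighted truncation of M8 is replaced by an `ε`-rescaling and its
`K²` disappears for every order: substitute the degeneration `a ↦ εa, b ↦ εb, c_q ↦ ε V_q`
(cost-free, over `ℂ((ε))`): `f_q ↦ ε V_q - ε² (ab)_q`, so
`f_q^k ↦ ε^k V_q^k - k ε^{k+1} V_q^{k-1} (ab)_q + (forms of degree ≥ 4)`, and the `a ⊗ b`-block of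
`-ε^{-(k+1)} k^{-1} V_q^{1-k} · f_q^k(εa, εb, εV)` is EXACTLY `(ab)_q`.  Andrews' border form of
`R ≤ 2 L` (`algBorderRank_le_of_isNonscalarSeq_laurent`) gives `bR(⟨n,n,n⟩) ≤ 2N` for every
exponent vector (`algBorderRank_le_of_powersFree`), and Bini's theorem turns border families of
cost `O(n^β)` into `ω ≤ β` (`omega_le_of_algBorderRank_bound`, `omega_le_of_powersFree`).

**Why this matters for the crux.**  The obstruction to reading a correct system is not the
MULTIPLICITY of the fat point (the `ε`-weights absorb it, as in Lickteig's proof that deciding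
`det = 1` has exponent `ω`; BCS Problem 16.3 is the graph version) but IMPURITY / MASKING of the
initial forms (M9a's `Purification`, NODE-g36 §4).  This file lands the hypothesis-free core.
-/

set_option linter.dupNamespace false

noncomputable section

open scoped BigOperators
namespace Summit.MatrixMultiplication.MatrixMultiplication.Theorems.GraphEquations

open MvPolynomial
open Literature.Computability.AlgebraicComplexity

variable {n : ℕ}

/-! ## The bilinear block of `(ab)_q` and of the powers `(α - β·(ab)_q)^k` -/

/-- `(ab)_q = Σ_k a_{q₁ k} b_{k q₂}` over a commutative ring `R`. -/
def abPoly (R : Type*) [CommRing R] (n : ℕ) (q : Fin n × Fin n) : MvPolynomial (GraphVars n) R :=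
  ∑ k : Fin n, X (Sum.inl (Sum.inl (q.1, k))) * X (Sum.inl (Sum.inr (k, q.2)))

/-- The exponent of the bilinear monomial `a_{ij} b_{j'l}`. -/
def abMono (n : ℕ) (i j j' l : Fin n) : GraphVars n →₀ ℕ :=
  Finsupp.single (Sum.inl (Sum.inl (i, j))) 1 + Finsupp.single (Sum.inl (Sum.inr (j', l))) 1

/-- `f_q = c_q - (ab)_q`. -/
theorem generator_eq_X_sub_abPoly (q : Fin n × Fin n) : generator n q = X (Sum.inr q) - abPoly ℂ n q :=
  rfl

/-- `(ab)_q` commutes with base change. -/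
theorem map_abPoly {R : Type*} [CommRing R] (f : ℂ →+* R) (q : Fin n × Fin n) :
    map f (abPoly ℂ n q) = abPoly R n q := by
  simp [abPoly, map_sum]

/-- `(ab)_q` is a quadratic form. -/
theorem isHomogeneous_abPoly (R : Type*) [CommRing R] (q : Fin n × Fin n) :
    (abPoly R n q).IsHomogeneous 2 := by
  unfold abPoly
  refine IsHomogeneous.sum _ _ _ fun k _ => ?_
  exact (isHomogeneous_X R _).mul (isHomogeneous_X R _)

/-- The degree of `a_{ij} b_{j'l}` is `2`. -/
theorem degree_abMono (i j j' l : Fin n) : (abMono n i j j' l).degree = 2 := by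
  simp [abMono, map_add, Finsupp.degree_single]

/-- The `a_{ij} b_{j'l}`-coefficient of `(ab)_q` is `[j = j'][q = (i,l)]` (over `ℂ`, from the
generator's coefficient). -/
theorem coeff_abMono_abPoly_complex (q : Fin n × Fin n) (i j j' l : Fin n) :
    coeff (abMono n i j j' l) (abPoly ℂ n q) =
      if j = j' then (if q = (i, l) then (1 : ℂ) else 0) else 0 := by
  classical
  have h := coeff_ab_generator q i j j' l
  unfold abMono
  rw [generator_eq_X_sub_abPoly, coeff_sub, coeff_X, if_neg] at h
  · simpa using h
  · intro hq
    have := Finsupp.ext_iff.1 hq (Sum.inr q)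
    simp at this

/-- The same over any `ℂ`-algebra. -/
theorem coeff_abMono_abPoly {R : Type*} [CommRing R] [Algebra ℂ R] (q : Fin n × Fin n)
    (i j j' l : Fin n) :
    coeff (abMono n i j j' l) (abPoly R n q) =
      if j = j' then (if q = (i, l) then (1 : R) else 0) else 0 := by
  rw [← map_abPoly (algebraMap ℂ R), coeff_map, coeff_abMono_abPoly_complex]
  split_ifs <;> simp

/-- Top-degree coefficients of a product with a form: if `P` is homogeneous of degree `d` and
`deg m = d`, then `coeff_m (Y · P) = coeff_0 Y · coeff_m P`. -/
theorem coeff_mul_of_isHomogeneous_of_degree_eq {R : Type*} [CommRing R] {σ : Type*}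
    {P Y : MvPolynomial σ R} {d : ℕ} (hP : P.IsHomogeneous d) {m : σ →₀ ℕ} (hm : m.degree = d) :
    coeff m (Y * P) = coeff 0 Y * coeff m P := by
  classical
  rw [coeff_mul]
  refine Finset.sum_eq_single (0, m) (fun x hx hne => ?_) (fun h => absurd (by simp) h)
  have hsum : x.1 + x.2 = m := by simpa using hx
  have hx1 : x.1 ≠ 0 := by
    intro h0
    apply hne
    have : x.2 = m := by simpa [h0] using hsum
    exact Prod.ext h0 this
  have hdeg : x.2.degree ≠ d := by
    intro hd
    have h1 : x.1.degree + x.2.degree = m.degree := by rw [← map_add, hsum]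
    rw [hd, hm] at h1
    have : x.1.degree = 0 := by omega
    exact hx1 ((Finsupp.degree_eq_zero_iff _).1 this)
  rw [hP.coeff_eq_zero hdeg, mul_zero]

/-- The constant coefficient of `(C α - C β · P)^k` for a form `P` of positive degree is `α^k`. -/
theorem constantCoeff_pow_C_sub {R : Type*} [CommRing R] {σ : Type*} {P : MvPolynomial σ R}
    {d : ℕ} (hP : P.IsHomogeneous d) (hd : d ≠ 0) (α β : R) (k : ℕ) :
    coeff 0 ((C α - C β * P) ^ k) = α ^ k := by
  have h0 : coeff 0 P = 0 := hP.coeff_eq_zero (by simpa using hd.symm)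
  have h0' : constantCoeff P = 0 := by rw [constantCoeff_eq]; exact h0
  have h1 : constantCoeff (C α - C β * P) = α := by
    simp [constantCoeff_C, h0']
  rw [← constantCoeff_eq, map_pow, h1]

/-- **The bilinear block of a pure power under degeneration.**
`coeff_{a_{ij} b_{j'l}} (C α - C β·(ab)_q)^k = -(k α^{k-1} β)·[j = j'][q = (i,l)]`:
only the term linear in `(ab)_q` has a bilinear block (`(ab)_q^j` is a form of degree `2j`). -/
theorem coeff_abMono_pow_C_sub {R : Type*} [CommRing R] [Algebra ℂ R] (α β : R)
    (q : Fin n × Fin n) (k : ℕ) (i j j' l : Fin n) :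
    coeff (abMono n i j j' l) ((C α - C β * abPoly R n q) ^ k) =
      -((k : R) * α ^ (k - 1) * β) * (if j = j' then (if q = (i, l) then 1 else 0) else 0) := by
  induction k with
  | zero =>
    have : coeff (abMono n i j j' l) (1 : MvPolynomial (GraphVars n) R) = 0 := by
      rw [coeff_one, if_neg]
      intro h
      have := congrArg Finsupp.degree h
      rw [degree_abMono] at this
      simp at this
    simp [this]
  | succ k ih =>
    rw [pow_succ, mul_sub, coeff_sub, mul_comm _ (C α), coeff_C_mul, ih,
      show (C α - C β * abPoly R n q) ^ k * (C β * abPoly R n q) =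
        C β * ((C α - C β * abPoly R n q) ^ k * abPoly R n q) by ring,
      coeff_C_mul, coeff_mul_of_isHomogeneous_of_degree_eq (isHomogeneous_abPoly R q)
        (degree_abMono i j j' l),
      constantCoeff_pow_C_sub (isHomogeneous_abPoly R q) two_ne_zero, coeff_abMono_abPoly]
    cases k with
    | zero =>
      simp only [pow_zero, zero_add, Nat.cast_zero, zero_mul, neg_zero, zero_tsub, pow_zero,
        Nat.cast_one, one_mul, mul_one]
      split_ifs <;> simp
    | succ k =>
      simp only [add_tsub_cancel_right, Nat.cast_add, Nat.cast_one]
      ring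


/-! ## The degeneration `a ↦ εa, b ↦ εb, c ↦ εV` over `ℂ((ε))` -/

/-- The uniformizer `ε` of `ℂ((ε))`. -/
def bEps : LaurentSeries ℂ := HahnSeries.single 1 1

/-- `ε⁻¹`. -/
def bEpsInv : LaurentSeries ℂ := HahnSeries.single (-1) 1
/-- `ε⁻¹ · ε = 1`. -/
theorem bEpsInv_mul_bEps : bEpsInv * bEps = 1 := by
  rw [bEpsInv, bEps, HahnSeries.single_mul_single]; simp

/-- `ε^{-k} · ε^k = 1`. -/
theorem bEpsInv_pow_mul_bEps_pow (k : ℕ) : bEpsInv ^ k * bEps ^ k = 1 := by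
  rw [← mul_pow, bEpsInv_mul_bEps, one_pow]

/-- The degeneration substitution with normal offset `V` (base point `A = B = 0`):
`a ↦ εa`, `b ↦ εb`, `c_q ↦ ε V_q`. -/
def degSubst (V : Fin n × Fin n → ℂ) : GraphVars n → MvPolynomial (GraphVars n) (LaurentSeries ℂ)
  | Sum.inl v => C bEps * X (Sum.inl v)
  | Sum.inr q => C (bEps * algebraMap ℂ (LaurentSeries ℂ) (V q))

/-- The substitution is affine-linear, hence cost-free. -/
theorem degSubst_mem_freeSpan (V : Fin n × Fin n → ℂ)
    (S : Set (MvPolynomial (GraphVars n) (LaurentSeries ℂ))) (v : GraphVars n) :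
    degSubst V v ∈ freeSpan S := by
  cases v with
  | inl v =>
    simp only [degSubst]
    rw [← smul_eq_C_mul]
    exact Submodule.smul_mem _ _ (X_mem_freeSpan S _)
  | inr q => exact C_mem_freeSpan S _

/-- **`f_q ↦ ε V_q - ε² (ab)_q`.** -/
theorem aeval_degSubst_generator (V : Fin n × Fin n → ℂ) (q : Fin n × Fin n) :
    aeval (degSubst V) (map (algebraMap ℂ (LaurentSeries ℂ)) (generator n q)) =
      C (bEps * algebraMap ℂ (LaurentSeries ℂ) (V q)) -
        C (bEps ^ 2) * abPoly (LaurentSeries ℂ) n q := by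
  rw [generator_eq_X_sub_abPoly, map_sub, map_X, map_abPoly, map_sub, aeval_X]
  simp only [degSubst, abPoly, map_sum, map_mul, aeval_X, Finset.mul_sum]
  refine congrArg₂ _ rfl (Finset.sum_congr rfl fun k _ => ?_)
  rw [pow_two, C_mul]
  ring

/-- **Free transport along a cost-free substitution over `ℂ((ε))`.**  A family free over a
nonscalar sequence of length `≤ N` over `ℂ` stays free (same length) after extension of scalars to
`ℂ((ε))` and an affine-linear substitution `θ`. -/
theorem exists_free_aeval_map {N : ℕ} {ο : Type*} (t : ο → MvPolynomial (GraphVars n) ℂ)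
    (hfree : ∃ gs : List (MvPolynomial (GraphVars n) ℂ), IsNonscalarSeq gs ∧ gs.length ≤ N ∧
      ∀ o, t o ∈ freeSpan {x | x ∈ gs})
    (θ : GraphVars n → MvPolynomial (GraphVars n) (LaurentSeries ℂ))
    (hθ : ∀ v, θ v ∈ freeSpan {x | x ∈ ([] : List (MvPolynomial (GraphVars n) (LaurentSeries ℂ)))}) :
    ∃ gs : List (MvPolynomial (GraphVars n) (LaurentSeries ℂ)), IsNonscalarSeq gs ∧
      gs.length ≤ N ∧
      ∀ o, aeval θ (map (algebraMap ℂ (LaurentSeries ℂ)) (t o)) ∈ freeSpan {x | x ∈ gs} := by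
  obtain ⟨gs, hns, hlen, hmem⟩ := hfree
  have hns₁ := hns.map (algebraMap ℂ (LaurentSeries ℂ))
  obtain ⟨hns₂, hmem₂⟩ := IsNonscalarSeq.aeval_append (θ := θ) (hs := []) hθ isNonscalarSeq_nil hns₁
  refine ⟨(gs.map (map (algebraMap ℂ (LaurentSeries ℂ)))).map (aeval θ) ++ [], hns₂,
    by simpa using hlen, fun o => hmem₂ _ (map_mem_freeSpan_map _ (hmem o))⟩

/-! ## The border serve engine and the power read-out -/

/-- The matrix multiplication tensor entry in the `[j = j'][q = (i,l)]` form. -/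
theorem matMulTensor_eq_ite (q : Fin n × Fin n) (i j j' l : Fin n) :
    matMulTensor ℂ n n n q (i, j) (j', l) =
      if j = j' then (if q = (i, l) then (1 : ℂ) else 0) else 0 := by
  obtain ⟨q1, q2⟩ := q
  simp only [matMulTensor, Prod.mk.injEq]
  by_cases hjj : j = j'
  · subst hjj
    by_cases h : q1 = i ∧ q2 = l
    · simp [h]
    · rw [if_neg, if_pos rfl, if_neg h]
      rintro ⟨h1, -, h3⟩
      exact h ⟨h1, h3⟩
  · simp [hjj]

/-- **THE BORDER SERVE ENGINE** (Andrews' Lemma 7 in the tree's graph-equation coordinates).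
Outputs `p_q ∈ ℂ((ε))[a,b,c]` in the cost-free span of one nonscalar sequence of length `≤ N` over
`ℂ((ε))`, whose `a ⊗ b`-blocks are `(ab)_q + O(ε)`.  Then `bR(⟨n,n,n⟩) ≤ 2N`. -/
theorem algBorderRank_le_of_abBorderServed {N : ℕ}
    (p : Fin n × Fin n → MvPolynomial (GraphVars n) (LaurentSeries ℂ))
    (hspan : ∃ gs : List (MvPolynomial (GraphVars n) (LaurentSeries ℂ)), IsNonscalarSeq gs ∧
      gs.length ≤ N ∧ ∀ q, p q ∈ freeSpan {x | x ∈ gs})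
    (hserve : ∀ (q : Fin n × Fin n) (i j j' l : Fin n), IsOrdGE 1
      (coeff (abMono n i j j' l) (p q) - HahnSeries.C (matMulTensor ℂ n n n q (i, j) (j', l)))) :
    algBorderRank (matMulTensor ℂ n n n) ≤ 2 * N := by
  classical
  refine algBorderRank_le_of_isNonscalarSeq_laurent
    (fun a : Fin n × Fin n => (Sum.inl (Sum.inl a) : GraphVars n))
    (fun b : Fin n × Fin n => (Sum.inl (Sum.inr b) : GraphVars n))
    (fun a b h => by simp at h) p (matMulTensor ℂ n n n) hspan fun q a b => ?_
  obtain ⟨i, j⟩ := a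
  obtain ⟨j', l⟩ := b
  exact hserve q i j j' l

/-- **POWERS ARE FREE IN BORDER RANK.**  If the pure powers `f_q^{k_q}` (`k_q ≥ 1`, arbitrary) all
lie in the cost-free span of one nonscalar sequence of length `≤ N` over `ℂ`, then
`bR(⟨n,n,n⟩) ≤ 2N` — independently of the exponents (the exact tower reads the same family at rank
`≤ 2·3^{max k - 1}·N`): degenerate along `a ↦ εa, b ↦ εb, c ↦ ε·𝟙` and rescale the output
`f_q^{k_q}` by `-ε^{-(k_q+1)}/k_q`; its `a⊗b`-block is then exactly `(ab)_q`. -/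
theorem algBorderRank_le_of_powersFree {N : ℕ} (k : Fin n × Fin n → ℕ) (hk : ∀ q, 1 ≤ k q)
    (hfree : ∃ gs : List (MvPolynomial (GraphVars n) ℂ), IsNonscalarSeq gs ∧ gs.length ≤ N ∧
      ∀ q, generator n q ^ k q ∈ freeSpan {x | x ∈ gs}) :
    algBorderRank (matMulTensor ℂ n n n) ≤ 2 * N := by
  classical
  set L := LaurentSeries ℂ with hL
  set θ : GraphVars n → MvPolynomial (GraphVars n) (LaurentSeries ℂ) := degSubst fun _ => 1 with hθ
  obtain ⟨gs, hns, hlen, hmem⟩ := exists_free_aeval_map (fun q => generator n q ^ k q) hfree θ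
    (degSubst_mem_freeSpan _ _)
  set s : Fin n × Fin n → LaurentSeries ℂ := fun q =>
    -(bEpsInv ^ (k q + 1) * algebraMap ℂ (LaurentSeries ℂ) ((k q : ℂ)⁻¹)) with hs
  refine algBorderRank_le_of_abBorderServed
    (fun q => C (s q) * aeval θ (map (algebraMap ℂ (LaurentSeries ℂ)) (generator n q ^ k q)))
    ⟨gs, hns, hlen, fun q => ?_⟩ fun q i j j' l => ?_
  · rw [← smul_eq_C_mul]
    exact Submodule.smul_mem _ _ (hmem q)
  · -- the bilinear block is EXACTLY the matrix multiplication tensor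
    have hgen : aeval θ (map (algebraMap ℂ (LaurentSeries ℂ)) (generator n q ^ k q)) =
        (C (bEps * algebraMap ℂ (LaurentSeries ℂ) 1) -
          C (bEps ^ 2) * abPoly (LaurentSeries ℂ) n q) ^ k q := by
      rw [map_pow, map_pow, hθ, aeval_degSubst_generator]
    have hcoef : coeff (abMono n i j j' l)
        (C (s q) * aeval θ (map (algebraMap ℂ (LaurentSeries ℂ)) (generator n q ^ k q))) =
        HahnSeries.C (matMulTensor ℂ n n n q (i, j) (j', l)) := by
      rw [coeff_C_mul, hgen, coeff_abMono_pow_C_sub, matMulTensor_eq_ite, map_one, mul_one]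
      have hk1 : 1 ≤ k q := hk q
      have hkC : ((k q : ℂ)⁻¹ : ℂ) * (k q : ℂ) = 1 := inv_mul_cancel₀ (Nat.cast_ne_zero.2 (by omega))
      have hkL : algebraMap ℂ (LaurentSeries ℂ) ((k q : ℂ)⁻¹) * (k q : LaurentSeries ℂ) = 1 := by
        rw [← map_natCast (algebraMap ℂ (LaurentSeries ℂ)), ← map_mul, hkC, map_one]
      have hε : bEpsInv ^ (k q + 1) * (bEps ^ (k q - 1) * bEps ^ 2) = 1 := by
        rw [← pow_add, show k q - 1 + 2 = k q + 1 by omega, bEpsInv_pow_mul_bEps_pow]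
      have hscal : s q * -((k q : LaurentSeries ℂ) * bEps ^ (k q - 1) * bEps ^ 2) = 1 := by
        rw [hs]
        calc -(bEpsInv ^ (k q + 1) * algebraMap ℂ (LaurentSeries ℂ) ((k q : ℂ)⁻¹)) *
              -((k q : LaurentSeries ℂ) * bEps ^ (k q - 1) * bEps ^ 2)
            = (bEpsInv ^ (k q + 1) * (bEps ^ (k q - 1) * bEps ^ 2)) *
                (algebraMap ℂ (LaurentSeries ℂ) ((k q : ℂ)⁻¹) * (k q : LaurentSeries ℂ)) := by ring
          _ = 1 := by rw [hε, hkL, one_mul]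
      rw [← mul_assoc, hscal, one_mul]
      split_ifs <;> simp
    rw [hcoef, sub_self]
    exact IsOrdGE.zero 1

/-! ## From border families to the exponent (Bini) -/

/-- `bR(⟨n,n,n⟩) ≥ 1` for `n ≥ 1`. -/
theorem one_le_algBorderRank_matMulCube (hn : 1 ≤ n) :
    1 ≤ algBorderRank (matMulTensor ℂ n n n) := by
  refine one_le_algBorderRank_of_ne_zero fun h => ?_
  have i0 : Fin n := ⟨0, hn⟩
  have := congrFun (congrFun (congrFun h (i0, i0)) (i0, i0)) (i0, i0)
  simp [matMulTensor] at this

/-- **Border families of cost `O(n^β)` give `ω ≤ β`** (Bini, `Blaser2013_thm66`, in the family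
form the dials use): if `bR(⟨n,n,n⟩) ≤ c·n^β` for all `n ≥ 1` then `ω(ℂ) ≤ β`. -/
theorem omega_le_of_algBorderRank_bound {β c : ℝ}
    (h : ∀ n : ℕ, 1 ≤ n → (algBorderRank (matMulTensor ℂ n n n) : ℝ) ≤ c * (n : ℝ) ^ β) :
    omega ℂ ≤ β := by
  -- `ω ≤ log_n bR(⟨n,n,n⟩) ≤ β + log c / log n` for every `n ≥ 2`
  have hc1 : (1 : ℝ) ≤ c := by
    have hb : (1 : ℝ) ≤ (algBorderRank (matMulTensor ℂ 1 1 1) : ℝ) := by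
      exact_mod_cast one_le_algBorderRank_matMulCube le_rfl
    simpa using hb.trans (h 1 le_rfl)
  have hstep : ∀ m : ℕ, 2 ≤ m → omega ℂ ≤ β + Real.log c / Real.log m := by
    intro m hm
    have hm1 : 1 ≤ m := by omega
    have hmR : (1 : ℝ) < m := by exact_mod_cast hm
    have hlogm : 0 < Real.log m := Real.log_pos hmR
    set r := algBorderRank (matMulTensor ℂ m m m) with hr
    have hr1 : 1 ≤ r := one_le_algBorderRank_matMulCube hm1
    have hB := Blaser2013_thm66_holds ℂ m m m r
      (by nlinarith [Nat.mul_le_mul hm hm, hm]) hr1 le_rfl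
    have hmmm : ((m * m * m : ℕ) : ℝ) = (m : ℝ) ^ (3 : ℕ) := by push_cast; ring
    have hlog3 : Real.log ((m * m * m : ℕ) : ℝ) = 3 * Real.log m := by
      rw [hmmm, Real.log_pow]; norm_num
    have hrpos : (0 : ℝ) < r := by exact_mod_cast hr1
    have hlogr : Real.log r ≤ Real.log c + β * Real.log m := by
      have h' := h m hm1
      rw [← hr] at h'
      have hcpos : 0 < c * (m : ℝ) ^ β := by positivity
      calc Real.log r ≤ Real.log (c * (m : ℝ) ^ β) := Real.log_le_log hrpos h'
        _ = Real.log c + β * Real.log m := by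
          rw [Real.log_mul (by positivity) (by positivity), Real.log_rpow (by positivity)]
    have hlogb : 3 * Real.logb ((m * m * m : ℕ) : ℝ) r = Real.log r / Real.log m := by
      rw [Real.logb, hlog3]
      field_simp
    calc omega ℂ ≤ 3 * Real.logb ((m * m * m : ℕ) : ℝ) r := hB
      _ = Real.log r / Real.log m := hlogb
      _ ≤ (Real.log c + β * Real.log m) / Real.log m :=
          div_le_div_of_nonneg_right hlogr hlogm.le
      _ = β + Real.log c / Real.log m := by field_simp; ring
  -- let `m → ∞`
  refine le_of_forall_gt_imp_ge_of_dense fun β' hβ' => ?_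
  have hlc : 0 ≤ Real.log c := Real.log_nonneg hc1
  obtain ⟨m, hm⟩ := exists_nat_ge (max 2 (Real.exp (Real.log c / (β' - β)) + 1))
  have hm2 : (2 : ℝ) ≤ m := (le_max_left _ _).trans hm
  have hm2' : 2 ≤ m := by exact_mod_cast hm2
  have hexp : Real.exp (Real.log c / (β' - β)) ≤ m := by linarith [(le_max_right _ _).trans hm]
  have hlogm : Real.log c / (β' - β) ≤ Real.log m := by
    simpa [Real.log_exp] using Real.log_le_log (Real.exp_pos _) hexp
  have hlogmpos : 0 < Real.log m := Real.log_pos (by linarith)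
  have hquot : Real.log c / Real.log m ≤ β' - β := by
    rw [div_le_iff₀ hlogmpos]
    have := mul_le_mul_of_nonneg_left hlogm (sub_pos.2 hβ').le
    rw [mul_div_cancel₀ _ (ne_of_gt (sub_pos.2 hβ'))] at this
    linarith
  linarith [hstep m hm2']

/-! ## The power dial in family currency -/

/-- `PowersFree β`: for all `n ≥ 1` some family of pure powers `f_q^{k_q}` (`k_q ≥ 1`, depending on
`n` and `q` arbitrarily — multiplicity UNBOUNDED) is free over a nonscalar sequence of length
`O(n^β)`.  No correctness, no membership, no flatness. -/
def PowersFree (β : ℝ) : Prop :=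
  ∃ c : ℝ, ∀ n : ℕ, 1 ≤ n → ∃ (N : ℕ) (k : Fin n × Fin n → ℕ), (∀ q, 1 ≤ k q) ∧
    (∃ gs : List (MvPolynomial (GraphVars n) ℂ), IsNonscalarSeq gs ∧ gs.length ≤ N ∧
      ∀ q, generator n q ^ k q ∈ freeSpan {x | x ∈ gs}) ∧ (N : ℝ) ≤ c * (n : ℝ) ^ β

/-- **`PowersFree β → ω ≤ β`**: the multiplicity-blind dial (the exact dials of
`GraphEquationsExponentDial`/`GraphEquationsSublogDial` need `3^{m(n)} = n^{o(1)}`). -/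
theorem omega_le_of_powersFree {β : ℝ} (h : PowersFree β) : omega ℂ ≤ β := by
  obtain ⟨c, hc⟩ := h
  refine omega_le_of_algBorderRank_bound (c := 2 * c) fun n hn => ?_
  obtain ⟨N, k, hk, hfree, hN⟩ := hc n hn
  have h1 : (algBorderRank (matMulTensor ℂ n n n) : ℝ) ≤ 2 * N := by
    exact_mod_cast algBorderRank_le_of_powersFree k hk hfree
  nlinarith [h1, hN]

/-- Hence power families cheaper than `ω` do not exist. -/
theorem not_powersFree_of_lt_omega {β : ℝ} (hβ : β < omega ℂ) : ¬ PowersFree β :=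
  fun h => (not_le.2 hβ) (omega_le_of_powersFree h)

/-- `PowersFree β` forces generically reduced correct systems at every `β' > β`: in border
currency the GE-BN1 asymmetry disappears. -/
theorem eqAdmissibleRed_of_powersFree {β β' : ℝ} (h : PowersFree β) (hβ' : β < β') :
    EqAdmissibleRed β' :=
  eqAdmissibleRed_of_omega_lt (lt_of_le_of_lt (omega_le_of_powersFree h) hβ')

end Summit.MatrixMultiplication.MatrixMultiplication.Theorems.GraphEquations
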